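import Summits.KontsevichZagierPeriods.KontsevichZagierPeriods.Theorems.TerasomaMultiplicationGammaHodgeSectorMultiplicationContainment
import Summits.KontsevichZagierPeriods.KontsevichZagierPeriods.Theorems.TerasomaMultiplicationGammaHodgeSectorTorsionKilling
import Summits.KontsevichZagierPeriods.KontsevichZagierPeriods.Theorems.TerasomaMultiplicationGammaHodgeSectorSelbergSector
import Summits.KontsevichZagierPeriods.KontsevichZagierPeriods.Theorems.TerasomaMultiplicationGammaHodgeFromRelators
import Summits.KontsevichZagierPeriods.KontsevichZagierPeriods.Theorems.TerasomaMultiplicationGapSectorBeyondTwelve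
import Summits.KontsevichZagierPeriods.KontsevichZagierPeriods.Theorems.TerasomaMultiplicationDasGapTwelveScaled
import Summits.KontsevichZagierPeriods.KontsevichZagierPeriods.Theorems.MultiplicationAccessible.Negative.Core

/-!
# `GammaHodgeSector` (stmt-KontsevichZagierPeriods-3742) — its exact position among the cruxes

Bookkeeping corollaries of the containment `GammaHodgeSector → MultiplicationAccessible`
(`…GammaHodgeSectorMultiplicationContainment.lean`) with the landed reductions of the line
`koblitz-ogus-halving` and of the relator compiler, for the planners' cone (all kernel-checked, no
new mathematics):

* `gammaHodgeSector_iff_multiplicationAccessible_of_positiveCancellation` — given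
  `PositiveCancellation` (stmt-5621, root extraction / cancellation in `P`):
  `GammaHodgeSector ↔ MultiplicationAccessible` (3742 ⟺ 12305);
* `gammaHodgeSector_iff_of_betaCancellation` — given `BetaCancellation` (stmt-13633):
  `GammaHodgeSector ↔ MultiplicationAccessible ∧ GapSectorBeyondTwelve` (3742 ⟺ 12305 ∧ 14858;
  `DasGapTwelve` 13215 and Euler reflection 3383 being PROVED in the tree);
* `gammaHodgeSector_and_multiplicationAccessible_of_selbergGammaSector` — SelbergAMGM's Γ-sector
  (stmt-5620) contains both cruxes 5 and 3 of route TerasomaMultiplication;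
* `valueIdentity_holds` — the value identity of the multiplication pair (Gauss multiplication in
  Beta form) in the vocabulary of the `MultiplicationAccessible` disprover
  (`MultiplicationAccessible.Negative.ValueIdentity`, there a HYPOTHESIS) is DISCHARGED, so
  `multiplicationAccessible_of_summit` : crux 3 is summit-implied UNCONDITIONALLY (also directly:
  summit → `GammaHodgeSector` → `MultiplicationAccessible`).

References: Deligne, LNM 900 §7 (Thm 7.18); Das 2000; Kontsevich–Zagier 2001 §1.2.
-/

noncomputable section

open scoped BigOperators

namespace Summit.KontsevichZagierPeriods.GammaHodgeSectorKO

open Literature.NumberTheory.Transcendental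
open Literature.NumberTheory.Transcendental.KZ
open Summit.KontsevichZagierPeriods.GammaHodgeSectorNegative (IsCubeBetaRep value_of_isCubeBetaRep)
open Summit.KontsevichZagierPeriods.MultiplicationAccessible.Negative (ValueIdentity)

open Summit.KontsevichZagierPeriods.KontsevichZagierPeriods.Theses.TerasomaMultiplication
  (GammaHodgeSector MultiplicationAccessible BetaCancellation GapSectorBeyondTwelve)
open Summit.KontsevichZagierPeriods.KontsevichZagierPeriods.Theses.SelbergAMGM
  (GammaSector PositiveCancellation)

/-- **Given root extraction, crux 5 IS crux 3**: `PositiveCancellation (stmt-5621) →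
(GammaHodgeSector ↔ MultiplicationAccessible)` — the containment of this seat one way, the line's
composition `gammaHodgeSector_of_selbergPositiveCancellation` the other way.
[cite: Deligne1982HodgeCycles, Thm. 7.18] -/
theorem gammaHodgeSector_iff_multiplicationAccessible_of_positiveCancellation
    (hPC : PositiveCancellation) : GammaHodgeSector ↔ MultiplicationAccessible :=
  ⟨multiplicationAccessible_of_gammaHodgeSector,
    fun hM => gammaHodgeSector_of_selbergPositiveCancellation hPC hM⟩

/-- **Given Beta cancellation, crux 5 is crux 3 plus the gap sector beyond level 12**:
`BetaCancellation (stmt-13633) → (GammaHodgeSector ↔ MultiplicationAccessible ∧ GapSectorBeyondTwelve)`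
— forward by the containment and `GapSectorBeyondTwelve.of_gammaHodgeSector`; backward by the
relator compiler `gammaHodgeFromRelators_proof` fed with the PROVED `dasGapTwelve_holds` (13215) and
`BetaCancellationLine.stub_eulerReflection` (3383). [cite: Deligne1982HodgeCycles, Thm. 7.18] -/
theorem gammaHodgeSector_iff_of_betaCancellation (hB : BetaCancellation) :
    GammaHodgeSector ↔ (MultiplicationAccessible ∧ GapSectorBeyondTwelve) :=
  ⟨fun h => ⟨multiplicationAccessible_of_gammaHodgeSector h,
      Summit.KontsevichZagierPeriods.TerasomaMultiplication.GapSectorBeyondTwelve.of_gammaHodgeSector h⟩,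
    fun h => Summit.KontsevichZagierPeriods.TerasomaMultiplication.GammaHodgeFromRelators.gammaHodgeFromRelators_proof
      h.1 hB Summit.KontsevichZagierPeriods.TerasomaMultiplication.DasGapTwelve.dasGapTwelve_holds h.2
      Summit.KontsevichZagierPeriods.KontsevichZagierPeriods.BetaCancellationLine.stub_eulerReflection⟩

/-- **SelbergAMGM's Γ-sector contains cruxes 5 and 3 of route TerasomaMultiplication**:
`GammaSector (stmt-5620) → GammaHodgeSector ∧ MultiplicationAccessible`. [cite: Deligne1982HodgeCycles, Thm. 7.18] -/
theorem gammaHodgeSector_and_multiplicationAccessible_of_selbergGammaSector (hΓ : GammaSector) :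
    GammaHodgeSector ∧ MultiplicationAccessible :=
  ⟨gammaHodgeSector_of_selbergGammaSector hΓ, multiplicationAccessible_of_selbergGammaSector hΓ⟩


/-- **The value identity of the multiplication pair holds** (Gauss's multiplication formula in Beta
form, `prod_beta_mult`, with the value formulas of the two pinned representations): the hypothesis
`ValueIdentity` of the `MultiplicationAccessible` disprover's `multiplicationAccessible_of_summit`
(`Theorems/MultiplicationAccessible/Negative/Core.lean`) is discharged. [cite: AndrewsAskeyRoy1999, Thm 1.5.2] -/
theorem valueIdentity_holds : ValueIdentity := by
  intro m s _ hs r r' hr hr'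
  classical
  set y' : Fin m → ℚ := fun j => (((j : ℕ) : ℚ) + 1) * s with hy'def
  have hy'pos : ∀ j, 0 < y' j := fun j => by positivity
  have hκ := isAlgebraic_gaussMultConst m s
  have hsR : (0:ℝ) < (s:ℝ) := by exact_mod_cast hs
  have hpos : ∀ i : Fin m, 0 < (fun i : Fin m => (((i : ℕ) : ℚ) + 1) / ((m : ℚ) + 1)) i ∧
      0 < (fun _ : Fin m => s) i := fun i => ⟨by positivity, hs⟩
  have hbox : IsCubeBetaRep (fun i : Fin m => (((i : ℕ) : ℚ) + 1) / ((m : ℚ) + 1)) (fun _ => s) r :=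
    isCubeBetaRep_multBox m s r hr.1 hr.2
  rw [value_of_isCubeBetaRep hpos hbox]
  have e3 : toFormalPeriod (of r') =
      kap _ hκ * ∏ j, toFormalPeriod (of (betaRep s (y' j) hs (hy'pos j))) :=
    bigSimplex_toFormalPeriod m s hs r' hr'.1 hr'.2 y' (fun j => rfl)
      (fun j => betaRep s (y' j) hs (hy'pos j)) (fun j => rfl) (fun j => fun _ _ => rfl) hκ
  have hv' : r'.value = ((m:ℝ) + 1) ^ (((m:ℝ) + 1) * s - 1) * ∏ j, ProbabilityTheory.beta (s:ℝ) (y' j) := by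
    have h1 := congrArg evalP e3
    rw [evalP_toFormalPeriod_of, map_mul, evalP_kap, map_prod] at h1
    rw [h1]
    congr 1
    exact Finset.prod_congr rfl fun j _ => by rw [evalP_toFormalPeriod_of, betaRep_value]
  rw [hv']
  have hmain := prod_beta_mult m hsR
  have hxR : ∀ i : Fin m, (((((i : ℕ) : ℚ) + 1) / ((m : ℚ) + 1) : ℚ) : ℝ) =
      (((i : ℕ) : ℝ) + 1) / ((m : ℝ) + 1) := fun i => by push_cast; ring
  have hy'R : ∀ j : Fin m, ((y' j : ℚ) : ℝ) = (((j : ℕ) : ℝ) + 1) * s := fun j => by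
    simp only [hy'def]; push_cast; ring
  simp only [hxR, hy'R]
  exact hmain

/-- **Crux 3 is summit-implied, unconditionally**: `KontsevichZagierPeriods → MultiplicationAccessible`
(summit → `GammaHodgeSector` by `GammaHodgeSectorNegative.of_summit`, then the containment).
[cite: KontsevichZagier2001, §1.2 Conjecture 1] -/
theorem multiplicationAccessible_of_summit (h : KontsevichZagierPeriods) : MultiplicationAccessible :=
  multiplicationAccessible_of_gammaHodgeSector (Summit.KontsevichZagierPeriods.GammaHodgeSectorNegative.of_summit h)

end Summit.KontsevichZagierPeriods.GammaHodgeSectorKO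

end
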